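import Summits.BirchSwinnertonDyer.Rank1Residual.X11b.ClassClosureSymbolTablePeriodUnit
import Summits.BirchSwinnertonDyer.Rank1Residual.X11a.PrintDischargeMuAn
import Literature.NumberTheory.EllipticCurves.PAdicLFunctionRiemannSumCongruenceCertificateProofs
import Literature.NumberTheory.EllipticCurves.PlusSymbolBoundOddMultiplicativeProofs
import Literature.NumberTheory.EllipticCurves.LeadingTermPPartProofs
import HarnessLib

/-!
# Route `PrintX11a` (cell `bsd-print-x11a`, seat p3 — exceptional-zero / Mazur–Tate–Teitelbaum road):
# the TEICHMÜLLER-COSET `μ`-CERTIFICATE IN THE KERNEL — a unit coset sum of `p − 1` plus modular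
# symbols at ONE level gives a unit coefficient of `ϖ·L_p(E,T)`, hence `X11a.MuAnZeroAt W p`, hence
# (ty2's door) the Euler half `Typed.MissingUpperBoundAt W p` at a non-surjective X11a pair
# (`--supports stmt-BirchSwinnertonDyer-20614 --as helper`; children U5 `UpperNonSurjFive` / U3
# `UpperNonSurjThree` of crux 3 `X11aNonSurjEulerHalf`)

WHY. The cell's per-pair currency on the HARD sub-locus of the non-surjective X11a pairs (split at
`p`, or `L(E,1)/Ω_E` not a `p`-adic unit; 37 pairs of the census) is ty3's two-engine `μ`-WITNESS
(`X11aPrintCertificates/RecordsLeafNonSurjMuPart1–2.lean`, `RecordsThreeNonSurjMu.lean`): a level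
`m`, a Teichmüller coset `u·μ_{p−1} ⊂ (ℤ/p^m)^×` and the `p − 1` plus modular symbols `x(a/p^m)`
(`x = ϖ·[·]⁺_f`, `x(0) = L(E,1)/Ω_E`) on it, whose SUM is a `p`-adic unit. So far the step «unit
coset sum ⇒ some coefficient of `ϖ·L_p` is a unit» was CLAIM-level (`Record.MuClaim`, a `Prop` to be
assumed: "the Mahler/Iwasawa-isomorphism step … standard but NOT a tree theorem", `ClaimMu.lean`;
ty3 g2 open item (iv), lit g5 (v)). THIS FILE PROVES IT, for THE Mazur–Tate–Teitelbaum function of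
the interpolation package (`IsSplitMultPAdicLFunctionOf` / `IsMultPAdicLFunctionOf f p (−1)`), from
tree theorems only:

* §1 (abstract, any bounded distribution `μ` on `ℤ_p^×` with `p`-integral values at level `n + e₀`):
  if ONE coset mass `ν(s₀) = ∑_ξ μ(ξγ^{s₀} + p^{n+e₀}ℤ_p)` is a unit, then SOME Riemann sum
  `RS k n = ∑_s ν(s)·(s choose k)` with `k < pⁿ` is a unit (`exists_norm_riemannSum_eq_one_of_cosetSum`):
  take `k` = the LARGEST `s ∈ [0, pⁿ)` with `‖ν(s)‖ = 1`; then `RS k n = ν(k) + ∑_{s > k} (s choose k)ν(s)`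
  with every `‖ν(s)‖ < 1` for `s > k` — the matrix `((s choose k))_{s,k}` is unipotent.
* §2 the Teichmüller coset as a DECIDABLE finset: for odd `p`, `{ξ·γ^{s₀} mod p^{n+1} : ξ ∈ μ_{p−1}}
  = {b : b^{p−1} = γ^{(p−1)s₀}}` (`finsum_coset_eq_sum_filter`; `γ = 1 + p` has order `pⁿ`,
  `gcd(p − 1, p) = 1`, and `(ξ, s) ↦ ξγ^s` exhausts `(ℤ/p^{n+1})^×`, tree `classMap_injective`).
* §3 THE function: with the tree's congruence certificate MODULO `p`
  (`PAdicLFunctionRiemannSumCongruenceCertificateProofs`: `‖[T^k]L − RS k n‖ ≤ C·p⁻¹` for `k < pⁿ`,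
  Mazur–Tate–Teitelbaum §I.12–I.13 via Lucas) in the x-currency form of the N8 lane
  (`X11b.ClassClosure.norm_coeff_C_mul_eq_one_of_symbolTable_modP_{split,nonsplit}`): a `p`-INTEGRAL
  table `x = ϖ·[·]⁺_f` at all levels + ONE unit coset sum ⇒ `∃ k, ‖[T^k](ϖ·L)‖ = 1`.
* §4 (sequel file `PrintX11aMuCosetDoor.lean`) the all-levels integrality of `x` in ANALYTIC RANK ZERO at an odd multiplicative prime with
  `E[p]` irreducible: `‖[a/p^m]⁺_f‖ ≤ max(1, ‖[0]⁺_f‖)` (tree, Manin's cusp class of `1/p`,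
  `IsNewformOf.norm_ratPlusSymbol_val_div_le_max_of_multiplicative`), `‖ϖ‖_p = 1` (Mazur 1978 Cor. 4.1,
  named fact `mazur_not_dvd_maninConstant_of_odd`, via the N8 lane's
  `X11b.ClassClosure.norm_ratCast_periodRatio_eq_one_of_mazur`) and `ϖ·[0]⁺_f = L(E,1)/Ω_E = t` with
  `‖t‖_p ≤ 1` (ONE displayed rational) ⇒ `‖x(a/p^m)‖_p ≤ 1` for all `m, a`.
* §5–§6 (sequel file `PrintX11aMuCosetDoor.lean`, ≤ 400 lines per file) **the door** `X11a.muAnZeroAt_of_cosetTable`: `W` globally minimal, `p` odd multiplicative,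
  `E[p]` irreducible, `L(E,1)/Ω_E = t` with `‖t‖_p ≤ 1`, a level `n`, an exponent `s₀`, a finite table
  `xs` on the coset `{b : b^{p−1} = γ^{(p−1)s₀}} ⊂ ℤ/p^{n+1}` with `ϖ·[b/p^{n+1}]⁺_f = xs b` (DISPLAYED,
  `p − 1` rationals — exactly ty3's `mu` column) and `‖∑_b xs b‖_p = 1` (KERNEL arithmetic) ⇒
  `X11a.MuAnZeroAt W p`, modulo Mazur's fact. §6 composes with ty2's part 6
  (`ClassX11a.missingUpperBoundAt_of_muAnZeroAt_of_not_surj[_of_nonsplit]`): crux-U currency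
  `Typed.MissingUpperBoundAt W p` per pair from the ten displayed facts (+ Greenberg–Stevens at a
  split pair) + Mazur + the table; and `BSDp W p` on a unit cell.

So a μ-witness record is no longer consumed through an ASSUMED `MuClaim` but through `p − 1` displayed
symbol VALUES (the same epistemic level as the unit-value door's single `L(E,1)/Ω_E`) plus kernel
arithmetic. HONEST FRAMING: per pair (E1 currency), never the leaf; the class-wide children U5/U3
(`∀` non-surjective X11a pairs) stay OPEN = Greenberg's `μ`-conjecture on the non-surjective locus
(barrier B3); theorems only, no definition, no new named fact, no `sorry`; beyond-print theorem: no
(MTT §I.12–I.13 + Manin + Mazur, assembled). Nothing is booked by this file.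

References: [MazurTateTeitelbaum1986Invent] §I.4 (4.2), §I.8, §I.10 (μ_E(a + pⁿℤ_p) = a_p^{−n}[a/pⁿ]⁺
at p ∣ N), §I.12–I.13 (P_n ≡ L mod ω_n); [SteinWuthrich2013] §3, §4.2; [CremonaAlgorithms1997] §2.2
Lemma 2.2.3, §2.8; [Mazur1978] Cor. 4.1; [GreenbergVatsal2000] §3 Rem. 3.4, p. 2–4;
[Washington1997] §5.1, §7.2; cell files HOME/TY3-CERTIFICATE-RECORDS.md §7, HOME/DOSSIER.md §26.2
(the μ-witness dictionary D1–D8), HOME/P3-EXCEPTIONAL-ZERO-ROAD.md §5–§7.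
-/

set_option autoImplicit false

noncomputable section

open scoped Classical MatrixGroups ModularForm

open CongruenceSubgroup WeierstrassCurve Literature.NumberTheory.EllipticCurves
  Literature.NumberTheory.EllipticCurves.ModularForms
  Literature.NumberTheory.EllipticCurves.Rank1Residual
  Literature.NumberTheory.EllipticCurves.Rank1Residual.Typed
  Literature.NumberTheory.EllipticCurves.Wuthrich2014
  Literature.NumberTheory.EllipticCurves.SteinWuthrich2013
  Literature.NumberTheory.EllipticCurves.Greenberg1999
  Literature.NumberTheory.EllipticCurves.Kato2004

namespace Summit.BirchSwinnertonDyer.Rank1Residual.X11a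

namespace MuCoset

/-! ### §1 Abstract: one unit coset mass ⇒ one unit Riemann sum below degree `pⁿ` -/

section Abstract

variable {p : ℕ} [Fact p.Prime] {μ : (n : ℕ) → ZMod (p ^ n) → ℚ_[p]} {RS : ℕ → ℕ → ℚ_[p]}
  (hRS : ∀ k m : ℕ, RS k m =
      ∑ᶠ ξ : rootsOfUnity (torsionOrder p) ℤ_[p], ∑ s : ZMod (p ^ m),
        μ (m + cyclotomicExponent p)
            (PadicInt.toZModPow (m + cyclotomicExponent p) ((ξ : ℤ_[p]ˣ) : ℤ_[p]) *
              (cyclotomicGenerator p : ZMod (p ^ (m + cyclotomicExponent p))) ^ s.val) *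
          ((s.val.choose k : ℕ) : ℚ_[p]))

include hRS

/-- **One unit coset mass gives one unit Riemann sum.** For a distribution `μ` on `ℤ_p^×` whose
values at level `n + e₀` are `p`-integral, if the mass `ν(s₀) = ∑_ξ μ(ξγ^{s₀} + p^{n+e₀}ℤ_p)` of ONE
ball `γ^{s₀}Γ^{pⁿ}` of `Γ = γ^{ℤ_p}` is a `p`-adic unit, then some Riemann sum
`RS k n = ∑_{s mod pⁿ} ν(s)·(s choose k)` with `k < pⁿ` is a `p`-adic unit: for `k` the LARGEST
`s ∈ [0, pⁿ)` with `‖ν(s)‖ = 1`, `RS k n = ν(k) + ∑_{s > k} (s choose k)·ν(s)` and every term with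
`s > k` has norm `< 1` (the Pascal matrix `((s choose k))` is unipotent; `ℚ_p` is ultrametric).
[cite: MazurTateTeitelbaum1986Invent, §I.12–I.13 (the Riemann polynomials P_n = ∑_s ν(s)(1+T)^s)]
[cite: Washington1997, §7.2 (Λ/ω_n ≅ ℤ_p[Γ_n])] -/
theorem exists_norm_riemannSum_eq_one_of_cosetSum {n : ℕ}
    (hint : ∀ a : ZMod (p ^ (n + cyclotomicExponent p)), ‖μ (n + cyclotomicExponent p) a‖ ≤ 1)
    (s₀ : ZMod (p ^ n))
    (hunit : ‖∑ᶠ ξ : rootsOfUnity (torsionOrder p) ℤ_[p],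
        μ (n + cyclotomicExponent p)
          (PadicInt.toZModPow (n + cyclotomicExponent p) ((ξ : ℤ_[p]ˣ) : ℤ_[p]) *
            (cyclotomicGenerator p : ZMod (p ^ (n + cyclotomicExponent p))) ^ s₀.val)‖ = 1) :
    ∃ k < p ^ n, ‖RS k n‖ = 1 := by
  classical
  haveI := neZero_torsionOrder p
  haveI := Fintype.ofFinite (rootsOfUnity (torsionOrder p) ℤ_[p])
  haveI : NeZero (p ^ n) := ⟨pow_ne_zero _ (Fact.out : p.Prime).ne_zero⟩
  -- the coset masses `ν(s)`
  set ν : ZMod (p ^ n) → ℚ_[p] := fun s ↦ ∑ ξ : rootsOfUnity (torsionOrder p) ℤ_[p],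
      μ (n + cyclotomicExponent p)
        (PadicInt.toZModPow (n + cyclotomicExponent p) ((ξ : ℤ_[p]ˣ) : ℤ_[p]) *
          (cyclotomicGenerator p : ZMod (p ^ (n + cyclotomicExponent p))) ^ s.val) with hν
  have hνle : ∀ s, ‖ν s‖ ≤ 1 := fun s ↦
    IsUltrametricDist.norm_sum_le_of_forall_le_of_nonneg zero_le_one fun ξ _ ↦ hint _
  have hν₀ : ‖ν s₀‖ = 1 := by
    rw [finsum_eq_sum_of_fintype] at hunit
    exact hunit
  have hRSn : ∀ k, RS k n = ∑ s : ZMod (p ^ n), ν s * ((s.val.choose k : ℕ) : ℚ_[p]) := by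
    intro k
    rw [hRS, finsum_eq_sum_of_fintype, Finset.sum_comm]
    simp only [hν, Finset.sum_mul]
  -- `k` := the largest index of a unit mass
  obtain ⟨s₁, hs₁, hmax⟩ := (Finset.univ.filter fun s : ZMod (p ^ n) ↦ ‖ν s‖ = 1).exists_max_image
    (fun s ↦ s.val) ⟨s₀, Finset.mem_filter.mpr ⟨Finset.mem_univ _, hν₀⟩⟩
  have hs₁' : ‖ν s₁‖ = 1 := (Finset.mem_filter.mp hs₁).2
  refine ⟨s₁.val, ZMod.val_lt s₁, ?_⟩
  rw [hRSn, ← Finset.add_sum_erase _ _ (Finset.mem_univ s₁), Nat.choose_self, Nat.cast_one, mul_one]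
  have hrest : ‖∑ s ∈ Finset.univ.erase s₁, ν s * ((s.val.choose s₁.val : ℕ) : ℚ_[p])‖ < 1 := by
    rcases (Finset.univ.erase s₁).eq_empty_or_nonempty with h | h
    · rw [h, Finset.sum_empty, norm_zero]; exact zero_lt_one
    · obtain ⟨s, hs, hle⟩ := IsUltrametricDist.exists_norm_finsetSum_le_of_nonempty h
        (fun s ↦ ν s * ((s.val.choose s₁.val : ℕ) : ℚ_[p]))
      refine hle.trans_lt ?_
      have hne : s ≠ s₁ := (Finset.mem_erase.mp hs).1
      by_cases hlt : s.val < s₁.val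
      · rw [Nat.choose_eq_zero_of_lt hlt, Nat.cast_zero, mul_zero, norm_zero]; exact zero_lt_one
      · have hgt : s₁.val < s.val :=
          lt_of_le_of_ne (not_lt.mp hlt) fun h ↦ hne (ZMod.val_injective _ h).symm
        have hnS : ‖ν s‖ ≠ 1 := fun h1 ↦
          absurd (hmax s (Finset.mem_filter.mpr ⟨Finset.mem_univ _, h1⟩)) (not_le.mpr hgt)
        have hlt1 : ‖ν s‖ < 1 := lt_of_le_of_ne (hνle s) hnS
        have hch := Padic.norm_int_le_one (p := p) ((s.val.choose s₁.val : ℕ) : ℤ)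
        rw [Int.cast_natCast] at hch
        rw [norm_mul]
        calc ‖ν s‖ * ‖((s.val.choose s₁.val : ℕ) : ℚ_[p])‖ ≤ ‖ν s‖ * 1 :=
              mul_le_mul_of_nonneg_left hch (norm_nonneg _)
          _ < 1 := by rwa [mul_one]
  have hne : ‖ν s₁‖ ≠ ‖∑ s ∈ Finset.univ.erase s₁, ν s * ((s.val.choose s₁.val : ℕ) : ℚ_[p])‖ := by
    rw [hs₁']; exact (ne_of_lt hrest).symm
  rw [IsUltrametricDist.norm_add_eq_max_of_norm_ne_norm hne, hs₁', max_eq_left hrest.le]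

end Abstract

/-! ### §2 The Teichmüller coset `{ξ·γ^{s₀}}` as a decidable finset (odd `p`) -/

section Coset

variable (p : ℕ) [Fact p.Prime]

/-- **Every unit class modulo `p^{n+e₀}` is some `ξ·γ^s`** (`ξ` a Teichmüller representative,
`s mod pⁿ`): surjectivity of the tree's class map, from its injectivity (`classMap_injective`) and the
equality of cardinalities (`card_classDomain`) (Washington §7.2: `ℤ_p^× = μ × γ^{ℤ_p}`). [folklore] -/
theorem exists_classMap_eq (n : ℕ) (u : (ZMod (p ^ (n + cyclotomicExponent p)))ˣ) :
    ∃ (ξ : rootsOfUnity (torsionOrder p) ℤ_[p]) (s : ZMod (p ^ n)),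
      PadicInt.toZModPow (n + cyclotomicExponent p) ((ξ : ℤ_[p]ˣ) : ℤ_[p]) *
        (cyclotomicGenerator p : ZMod (p ^ (n + cyclotomicExponent p))) ^ s.val =
          (u : ZMod (p ^ (n + cyclotomicExponent p))) := by
  classical
  haveI := neZero_torsionOrder p
  haveI := Fintype.ofFinite (rootsOfUnity (torsionOrder p) ℤ_[p])
  set Φ : rootsOfUnity (torsionOrder p) ℤ_[p] × ZMod (p ^ n) →
      (ZMod (p ^ (n + cyclotomicExponent p)))ˣ := fun x ↦ (isUnit_classMap p n x).unit with hΦ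
  have hΦinj : Function.Injective Φ := by
    intro x y hxy
    have h := congr_arg Units.val hxy
    simp only [hΦ, IsUnit.unit_spec] at h
    exact classMap_injective p n h
  have hΦbij : Function.Bijective Φ :=
    (Fintype.bijective_iff_injective_and_card Φ).mpr ⟨hΦinj, card_classDomain p n⟩
  obtain ⟨⟨ξ, s⟩, hx⟩ := hΦbij.2 u
  refine ⟨ξ, s, ?_⟩
  have h := congr_arg Units.val hx
  simp only [hΦ, IsUnit.unit_spec] at h
  exact h

/-- **The Teichmüller coset of `γ^{s₀}` modulo `p^{n+e₀}`, for odd `p`, is the finset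
`{b : b^{p−1} = γ^{(p−1)s₀}}`**: summing `g(ξ·γ^{s₀})` over the Teichmüller representatives `ξ` is
summing `g` over that (decidable) finset. `⊆`: `ξ^{p−1} = 1`. `⊇`: `b = ξ·γ^s` for some class
(`exists_classMap_eq`), and `γ^{(p−1)s} = γ^{(p−1)s₀}` forces `s = s₀` because `γ = 1 + p` has order
`pⁿ` modulo `p^{n+1}` (`orderOf_cyclotomicGenerator`) and `gcd(p − 1, p) = 1`; distinct `ξ` give
distinct classes (`classMap_injective`). This is the shape in which a record DISPLAYS its coset
(`Record.checkMu`: `a^{p−1} ≡ u^{p−1} (mod pⁿ)`). [cite: Washington1997, §5.1 and §7.2]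
[cite: MazurTateTeitelbaum1986Invent, §I.13] -/
theorem finsum_coset_eq_sum_filter (hp2 : p ≠ 2) (n : ℕ) (s₀ : ZMod (p ^ n))
    {M : Type*} [AddCommMonoid M] (g : ZMod (p ^ (n + cyclotomicExponent p)) → M) :
    ∑ᶠ ξ : rootsOfUnity (torsionOrder p) ℤ_[p],
        g (PadicInt.toZModPow (n + cyclotomicExponent p) ((ξ : ℤ_[p]ˣ) : ℤ_[p]) *
          (cyclotomicGenerator p : ZMod (p ^ (n + cyclotomicExponent p))) ^ s₀.val) =
      ∑ b ∈ Finset.univ.filter (fun b : ZMod (p ^ (n + cyclotomicExponent p)) ↦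
          b ^ torsionOrder p =
            (cyclotomicGenerator p : ZMod (p ^ (n + cyclotomicExponent p))) ^
              (torsionOrder p * s₀.val)), g b := by
  classical
  haveI := neZero_torsionOrder p
  haveI := Fintype.ofFinite (rootsOfUnity (torsionOrder p) ℤ_[p])
  haveI : NeZero (p ^ n) := ⟨pow_ne_zero _ (Fact.out : p.Prime).ne_zero⟩
  set γ : ZMod (p ^ (n + cyclotomicExponent p)) :=
    (cyclotomicGenerator p : ZMod (p ^ (n + cyclotomicExponent p))) with hγ
  set ψ : rootsOfUnity (torsionOrder p) ℤ_[p] → ZMod (p ^ (n + cyclotomicExponent p)) :=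
    fun ξ ↦ PadicInt.toZModPow (n + cyclotomicExponent p) ((ξ : ℤ_[p]ˣ) : ℤ_[p]) * γ ^ s₀.val
    with hψ
  have hψinj : Function.Injective ψ := by
    intro ξ ξ' h
    have h2 := classMap_injective p n (a₁ := (ξ, s₀)) (a₂ := (ξ', s₀)) h
    exact (Prod.ext_iff.mp h2).1
  have hclass : ∀ (ξ : rootsOfUnity (torsionOrder p) ℤ_[p]) (s : ZMod (p ^ n)),
      (PadicInt.toZModPow (n + cyclotomicExponent p) ((ξ : ℤ_[p]ˣ) : ℤ_[p]) * γ ^ s.val) ^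
          torsionOrder p = γ ^ (torsionOrder p * s.val) := by
    intro ξ s
    rw [mul_pow, ← map_pow, rootsOfUnity_pow_torsionOrder, map_one, one_mul, ← pow_mul, mul_comm]
  have himg : Finset.univ.image ψ =
      Finset.univ.filter (fun b : ZMod (p ^ (n + cyclotomicExponent p)) ↦
        b ^ torsionOrder p = γ ^ (torsionOrder p * s₀.val)) := by
    ext b
    simp only [Finset.mem_image, Finset.mem_univ, true_and, Finset.mem_filter]
    constructor
    · rintro ⟨ξ, rfl⟩
      exact hclass ξ s₀
    · intro hb
      have hτ : torsionOrder p ≠ 0 := (zero_lt_torsionOrder p).ne'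
      have hγu : IsUnit γ := isUnit_cyclotomicGenerator_cast p _
      have hbu : IsUnit b := (isUnit_pow_iff hτ).mp (hb ▸ hγu.pow _)
      obtain ⟨ξ, s, hξs⟩ := exists_classMap_eq p n hbu.unit
      rw [IsUnit.unit_spec] at hξs
      have hpow : γ ^ (torsionOrder p * s.val) = γ ^ (torsionOrder p * s₀.val) := by
        rw [← hb, ← hξs, hclass]
      have hfin : IsOfFinOrder γ := orderOf_pos_iff.mp (by
        rw [hγ, orderOf_cyclotomicGenerator]; exact pow_pos (Fact.out : p.Prime).pos _)
      rw [hfin.pow_eq_pow_iff_modEq, hγ, orderOf_cyclotomicGenerator] at hpow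
      have hcop : Nat.Coprime (p ^ n) (torsionOrder p) := by
        rw [torsionOrder_eq, if_neg hp2]
        exact ((Nat.coprime_self_sub_right (Fact.out : p.Prime).one_le).mpr
          (Nat.coprime_one_right p)).pow_left n
      have hs : s.val ≡ s₀.val [MOD p ^ n] := Nat.ModEq.cancel_left_of_coprime hcop hpow
      have hss : s = s₀ :=
        ZMod.val_injective _ (Nat.ModEq.eq_of_lt_of_lt hs (ZMod.val_lt s) (ZMod.val_lt s₀))
      subst hss
      exact ⟨ξ, hξs⟩
  rw [finsum_eq_sum_of_fintype, ← himg, Finset.sum_image fun ξ _ ξ' _ h ↦ hψinj h]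

end Coset

/-! ### §3 THE Mazur–Tate–Teitelbaum function: integral table + one unit coset sum ⇒ a unit coefficient of `ϖ·L` -/

section TheFunction

variable (W : WeierstrassCurve ℚ) [W.IsElliptic] (p : ℕ) [Fact p.Prime]

omit [W.IsElliptic] in
/-- **Split multiplicative `p`: a unit Teichmüller-coset sum of the table `x = ϖ·[·]⁺_f` at level
`n + e₀` gives a unit coefficient of `ϖ·L` below degree `pⁿ`**, for THE split function (every `L`
with `IsSplitMultPAdicLFunctionOf f p L`), provided the table is `p`-integral at all levels. §1 gives a
unit Riemann sum `RS k n` of the table with `k < pⁿ`; the tree's congruence certificate modulo `p`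
(`X11b.ClassClosure.norm_coeff_C_mul_eq_one_of_symbolTable_modP_split`, `C = 1`, `p⁻¹ < 1`) gives
`‖[T^k](ϖ·L)‖ = ‖RS k n‖ = 1`. [cite: MazurTateTeitelbaum1986Invent, §I.10 Prop., §I.12–I.13, §I.15]
[cite: SteinWuthrich2013, §3 and §4.2] -/
theorem exists_norm_coeff_eq_one_of_cosetSum_split {N : ℕ} [NeZero N]
    {f : CuspForm (Gamma0 N) 2} (hf : IsNewformOf W f)
    (hsplit : W.HasSplitMultiplicativeReductionAtPrime p) (ϖ : ℚ)
    (hint : ∀ (m : ℕ) (a : ZMod (p ^ m)),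
      ‖((ϖ * ratPlusSymbol f ((a.val : ℚ) / (p : ℚ) ^ m) : ℚ) : ℚ_[p])‖ ≤ 1)
    {n : ℕ} (s₀ : ZMod (p ^ n))
    (hunit : ‖∑ᶠ ξ : rootsOfUnity (torsionOrder p) ℤ_[p],
        ((ϖ * ratPlusSymbol f
          (((PadicInt.toZModPow (n + cyclotomicExponent p) ((ξ : ℤ_[p]ˣ) : ℤ_[p]) *
              (cyclotomicGenerator p : ZMod (p ^ (n + cyclotomicExponent p))) ^ s₀.val).val : ℚ) /
            (p : ℚ) ^ (n + cyclotomicExponent p)) : ℚ) : ℚ_[p])‖ = 1)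
    {L : PowerSeries ℚ_[p]} (hL : IsSplitMultPAdicLFunctionOf f p L) :
    ∃ k : ℕ, k < p ^ n ∧ ‖PowerSeries.coeff k (PowerSeries.C ((ϖ : ℚ) : ℚ_[p]) * L)‖ = 1 := by
  set x : ℚ → ℚ := fun r ↦ ϖ * ratPlusSymbol f r with hx
  set RS : ℕ → ℕ → ℚ_[p] := fun k m ↦
    ∑ᶠ ξ : rootsOfUnity (torsionOrder p) ℤ_[p], ∑ s : ZMod (p ^ m),
      (fun (m : ℕ) (a : ZMod (p ^ m)) ↦ (x ((a.val : ℚ) / (p : ℚ) ^ m) : ℚ_[p]))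
        (m + cyclotomicExponent p)
          (PadicInt.toZModPow (m + cyclotomicExponent p) ((ξ : ℤ_[p]ˣ) : ℤ_[p]) *
            (cyclotomicGenerator p : ZMod (p ^ (m + cyclotomicExponent p))) ^ s.val) *
        ((s.val.choose k : ℕ) : ℚ_[p]) with hRS
  obtain ⟨k, hk, hRk⟩ := exists_norm_riemannSum_eq_one_of_cosetSum
    (μ := fun (m : ℕ) (a : ZMod (p ^ m)) ↦ (x ((a.val : ℚ) / (p : ℚ) ^ m) : ℚ_[p])) (RS := RS)
    (fun _ _ ↦ rfl) (n := n) (fun a ↦ hint _ a) s₀ hunit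
  have h1 : ‖((1 : ℚ) : ℚ_[p])‖ = 1 := by rw [Rat.cast_one, norm_one]
  have hp1 : (1 : ℝ) * (p : ℝ)⁻¹ < ‖RS k n‖ := by
    rw [hRk, one_mul]
    exact inv_lt_one_of_one_lt₀ (by exact_mod_cast (Fact.out : p.Prime).one_lt)
  exact ⟨k, hk, X11b.ClassClosure.norm_coeff_C_mul_eq_one_of_symbolTable_modP_split W p hf hsplit h1
    (x := x) (fun r ↦ by rw [hx, one_mul]) (RS := RS) (fun _ _ ↦ rfl) (C := 1) hint hk hp1 hRk hL⟩

omit [W.IsElliptic] in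
/-- **Non-split multiplicative `p`** (THE non-split function, every `L` with
`IsMultPAdicLFunctionOf f p (−1) L`; the Riemann sums are those of the SIGNED table
`(−1)^m·x(a/p^m)`, whose coset sums have the same norm): a `p`-integral table `x = ϖ·[·]⁺_f` and ONE
unit Teichmüller-coset sum at level `n + e₀` give a unit coefficient of `ϖ·L` below degree `pⁿ`.
[cite: MazurTateTeitelbaum1986Invent, §I.10 Prop. (a_p = −1), §I.12–I.13] [cite: SteinWuthrich2013, §3 and §4.2] -/
theorem exists_norm_coeff_eq_one_of_cosetSum_nonsplit {N : ℕ} [NeZero N]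
    {f : CuspForm (Gamma0 N) 2} (hf : IsNewformOf W f)
    (hmult : W.HasMultiplicativeReductionAtPrime p)
    (hns : ¬ W.HasSplitMultiplicativeReductionAtPrime p) (ϖ : ℚ)
    (hint : ∀ (m : ℕ) (a : ZMod (p ^ m)),
      ‖((ϖ * ratPlusSymbol f ((a.val : ℚ) / (p : ℚ) ^ m) : ℚ) : ℚ_[p])‖ ≤ 1)
    {n : ℕ} (s₀ : ZMod (p ^ n))
    (hunit : ‖∑ᶠ ξ : rootsOfUnity (torsionOrder p) ℤ_[p],
        ((ϖ * ratPlusSymbol f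
          (((PadicInt.toZModPow (n + cyclotomicExponent p) ((ξ : ℤ_[p]ˣ) : ℤ_[p]) *
              (cyclotomicGenerator p : ZMod (p ^ (n + cyclotomicExponent p))) ^ s₀.val).val : ℚ) /
            (p : ℚ) ^ (n + cyclotomicExponent p)) : ℚ) : ℚ_[p])‖ = 1)
    {L : PowerSeries ℚ_[p]} (hL : IsMultPAdicLFunctionOf f p (-1) L) :
    ∃ k : ℕ, k < p ^ n ∧ ‖PowerSeries.coeff k (PowerSeries.C ((ϖ : ℚ) : ℚ_[p]) * L)‖ = 1 := by
  classical
  haveI := neZero_torsionOrder p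
  haveI := Fintype.ofFinite (rootsOfUnity (torsionOrder p) ℤ_[p])
  set x : ℚ → ℚ := fun r ↦ ϖ * ratPlusSymbol f r with hx
  set RS : ℕ → ℕ → ℚ_[p] := fun k m ↦
    ∑ᶠ ξ : rootsOfUnity (torsionOrder p) ℤ_[p], ∑ s : ZMod (p ^ m),
      (fun (m : ℕ) (a : ZMod (p ^ m)) ↦ (-1 : ℚ_[p]) ^ m * (x ((a.val : ℚ) / (p : ℚ) ^ m) : ℚ_[p]))
        (m + cyclotomicExponent p)
          (PadicInt.toZModPow (m + cyclotomicExponent p) ((ξ : ℤ_[p]ˣ) : ℤ_[p]) *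
            (cyclotomicGenerator p : ZMod (p ^ (m + cyclotomicExponent p))) ^ s.val) *
        ((s.val.choose k : ℕ) : ℚ_[p]) with hRS
  have hint' : ∀ a : ZMod (p ^ (n + cyclotomicExponent p)),
      ‖(-1 : ℚ_[p]) ^ (n + cyclotomicExponent p) *
        (x ((a.val : ℚ) / (p : ℚ) ^ (n + cyclotomicExponent p)) : ℚ_[p])‖ ≤ 1 := by
    intro a
    rw [norm_mul, norm_pow, norm_neg, norm_one, one_pow, one_mul]
    exact hint _ a
  have hunit' : ‖∑ᶠ ξ : rootsOfUnity (torsionOrder p) ℤ_[p],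
      (-1 : ℚ_[p]) ^ (n + cyclotomicExponent p) *
        (x ((((PadicInt.toZModPow (n + cyclotomicExponent p) ((ξ : ℤ_[p]ˣ) : ℤ_[p]) *
              (cyclotomicGenerator p : ZMod (p ^ (n + cyclotomicExponent p))) ^ s₀.val).val : ℚ) /
            (p : ℚ) ^ (n + cyclotomicExponent p))) : ℚ_[p])‖ = 1 := by
    rw [finsum_eq_sum_of_fintype, ← Finset.mul_sum, norm_mul, norm_pow, norm_neg, norm_one, one_pow,
      one_mul, ← finsum_eq_sum_of_fintype]
    exact hunit
  obtain ⟨k, hk, hRk⟩ := exists_norm_riemannSum_eq_one_of_cosetSum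
    (μ := fun (m : ℕ) (a : ZMod (p ^ m)) ↦
      (-1 : ℚ_[p]) ^ m * (x ((a.val : ℚ) / (p : ℚ) ^ m) : ℚ_[p])) (RS := RS)
    (fun _ _ ↦ rfl) (n := n) hint' s₀ hunit'
  have h1 : ‖((1 : ℚ) : ℚ_[p])‖ = 1 := by rw [Rat.cast_one, norm_one]
  have hp1 : (1 : ℝ) * (p : ℝ)⁻¹ < ‖RS k n‖ := by
    rw [hRk, one_mul]
    exact inv_lt_one_of_one_lt₀ (by exact_mod_cast (Fact.out : p.Prime).one_lt)
  exact ⟨k, hk, X11b.ClassClosure.norm_coeff_C_mul_eq_one_of_symbolTable_modP_nonsplit W p hf hmult hns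
    h1 (x := x) (fun r ↦ by rw [hx, one_mul]) (RS := RS) (fun _ _ ↦ rfl) (C := 1) hint hk hp1 hRk hL⟩

end TheFunction

end MuCoset

end Summit.BirchSwinnertonDyer.Rank1Residual.X11a

end
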